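import Summits.CriticalPhenomena.PercolationContinuityZ3.Theorems.Transplant.TwoAxisExitFrame
import HarnessLib

/-!
# N1 ({±1} node), hp-8 column (design owner's ruling 2026-08-21 13:19:49Z, KIT-FRAMES-N1.md (R3)): the FINE cell-aligned skeleton `Skelφ.fineSkel`
# (one multiplier PER AXIS — the cell map of the fine two-unit cells `PCells2 ⟨Kcell, m⟩`), the two FACE FRAMES `uFrame`/`vFrame` (= `Skelφ.exitFrame` at
# the cell's own level coordinate, raw coordinate `b`), and the READING LEMMAS between a face frame and the cell map

builds on p205010 (kernel theorem, internal audit signed; external expert review pending) — nothing in this file uses p205010; nothing here is a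
claim about the open node `SamePDropOfSkeletonNeg`.
Lane `prim-bschramm`, seat `prim-hp-8` (gen 33); helper file (`--supports stmt-CriticalPhenomena-4575 --as helper`).
WHY (KIT-FRAMES-N1 §2): kits need φ-fine, walkable window levels; coarse faces (one `ρ`-unit thick, `PCells2 ⟨K,1⟩` over `coarseSkel`) admit no such
frame in needle cells, fine faces do.  So the cell map becomes `fineSkel φ t A n h vα vβ c₀ c₁ s₀ s₁ D = (⌊(c₀λ₀ + s₀)/D⌋, ⌊(c₁λ₁ + s₁)/D⌋)` with
`c_i := 20K·m_i`, `m_i := ⌊D/(20K·L_i)⌋` (so `c_i·L_i ≤ D` by definition), and the cells are `PCells2 ⟨Kcell, m⟩` (`r_i = K·m_i` fine units `= K`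
ρ-units `= D/20` λ-units exactly; stride `= K·m_i/40` fine units).  `coarseSkel … c … = fineSkel … c c …` (`rfl`), so every landed `coarseSkel` lemma
is the diagonal case.  The face step at a u-face (level form `λ₁`, crossing axis `1`) runs its kit sweep in `uFrame := exitFrame φ t 1 b (−c₁Ah) (c₁An) D s₁`
whose coordinate `1` IS the cell coordinate (`uFrame_apply_one`), raw coordinate `b` (`= 0` iff `|h| ≤ n`); v-faces use `vFrame := exitFrame φ t 0 b
(c₀Avβ) (−c₀Avα) D s₀`.  The reading lemmas bound the OTHER cell coordinate along a face-frame box from the exact identities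
`n·λ₀ + vα·λ₁ = A·mod·α`, `h·λ₀ + vβ·λ₁ = A·mod·β` (`mul_lam_eq`) — with an explicit integer hypothesis discharged by the params column.
* §1 **`fineSkel`**, `coarseSkel_eq_fineSkel`, `fineSkel_apply_zero/one`, **`lip_fineSkel`**, **`fine_containment`**;
* §2 the frames **`uFrame`**, **`vFrame`**, `uFrame_apply_one/zero`, `vFrame_apply_zero/one`, `lip_uFrame/vFrame`, **`qSteps_uFrame`**, **`qSteps_vFrame`**;
* §3 `abs_mul_sub_lt_of_coarse` (levels `d` apart ⇒ `|cΔt| < (d+1)D`), the core reading lemma `abs_coarse_sub_le_of_identity`, and the four readings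
  **`uFrame_read_zero`** (`b = 0`: `n`), **`uFrame_read_zero'`** (`b = 1`: `h`), **`vFrame_read_one`** (`b = 0`: `vα`), **`vFrame_read_one'`** (`b = 1`: `vβ`).
[cite: MartineauTassion2017, §4.1 (the lattice z₁u + z₂v), §4.3] [cite: KozmaNitzan2024, §4 pp. 25–26 (cells), Lemma 10 Step III (p. 19)]
-/

namespace Summit.CriticalPhenomena.PercolationContinuityZ3.Theorems.Transplant

open Literature.Probability.LatticeModels

namespace TwoAxis.Para

/-! ### Two more `λ`-identities and the level-separation bound -/

/-- `n·λ₀ + vα·λ₁ = A·mod·x₀` and `h·λ₀ + vβ·λ₁ = A·mod·x₁` (the rows of `M·λ = D·x` divided by `A`). [folklore] -/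
theorem mul_lam_eq' (A n h vα vβ : ℤ) (x : Site 2) :
    n * lam0 A vα vβ x + vα * lam1 A n h x = A * modulus n h vα vβ * x 0 ∧
      h * lam0 A vα vβ x + vβ * lam1 A n h x = A * modulus n h vα vβ * x 1 := by
  unfold lam0 lam1 bp modulus; constructor <;> ring

/-- **Levels `d` apart are `< (d+1)·D` apart before coarsening**: `|ρ t − ρ t'| ≤ d` gives `|c·t − c·t'| < (d+1)·D` (`0 < D`). [folklore] -/
theorem abs_mul_sub_lt_of_coarse {c s D t t' d : ℤ} (hD : 0 < D) (h : |coarse c s D t - coarse c s D t'| ≤ d) :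
    |c * t - c * t'| < (d + 1) * D := by
  unfold coarse at h
  have h1 := Int.mul_ediv_add_emod (c * t + s) D
  have h2 := Int.mul_ediv_add_emod (c * t' + s) D
  have r1 := Int.emod_nonneg (c * t + s) hD.ne'
  have r1' := Int.emod_lt_of_pos (c * t + s) hD
  have r2 := Int.emod_nonneg (c * t' + s) hD.ne'
  have r2' := Int.emod_lt_of_pos (c * t' + s) hD
  rw [abs_le] at h
  rw [abs_lt]
  set q := (c * t + s) / D
  set q' := (c * t' + s) / D
  constructor <;> nlinarith [h.1, h.2, mul_le_mul_of_nonneg_left h.1 hD.le, mul_le_mul_of_nonneg_left h.2 hD.le]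

/-- **The core reading lemma**: from an exact identity `κ·L = A·mod·Δb − ν·L'` (the other dual coordinate's difference `L` against the raw difference
`Δb`, `|Δb| ≤ a`, and the level-coordinate difference `L'` with `|c_I·L'| < (d+1)·D`), `κ ≠ 0`, and the integer room
`c_o·c_I·|A·mod|·a + c_o·|ν|·(d+1)·D ≤ c_I·|κ|·k·D`, conclude `|c_o·L| ≤ k·D` (so the other fine coordinate moves by `≤ k`). [this work] -/
theorem abs_le_of_identity {κ L A' Δb ν L' cI co a d k D : ℤ} (hid : κ * L = A' * Δb - ν * L') (hκ : κ ≠ 0) (hcI : 0 < cI) (hco : 0 ≤ co)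
    (ha : |Δb| ≤ a) (hL' : |cI * L'| < (d + 1) * D) (hk : co * cI * |A'| * a + co * |ν| * (d + 1) * D ≤ cI * |κ| * k * D) :
    |co * L| ≤ k * D := by
  -- `cI·|κ|·|co·L| ≤ co·cI·|A'|·a + co·|ν|·(d+1)·D ≤ cI·|κ|·k·D`
  have hκ0 : 0 < |κ| := abs_pos.2 hκ
  have h1 : cI * |κ| * |co * L| = co * |cI * (κ * L)| := by
    rw [abs_mul, abs_mul, abs_mul, abs_of_nonneg hco, abs_of_pos hcI]; ring
  have h2 : |cI * (κ * L)| ≤ cI * |A'| * a + |ν| * ((d + 1) * D) := by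
    rw [hid, mul_sub]
    calc |cI * (A' * Δb) - cI * (ν * L')| ≤ |cI * (A' * Δb)| + |cI * (ν * L')| := abs_sub _ _
      _ = cI * |A'| * |Δb| + |ν| * |cI * L'| := by
          rw [abs_mul, abs_mul, abs_of_pos hcI, show cI * (ν * L') = ν * (cI * L') by ring, abs_mul]; ring
      _ ≤ cI * |A'| * a + |ν| * ((d + 1) * D) := by gcongr
  have h3 : cI * |κ| * |co * L| ≤ cI * |κ| * (k * D) := by
    rw [h1]
    calc co * |cI * (κ * L)| ≤ co * (cI * |A'| * a + |ν| * ((d + 1) * D)) := mul_le_mul_of_nonneg_left h2 hco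
      _ = co * cI * |A'| * a + co * |ν| * (d + 1) * D := by ring
      _ ≤ cI * |κ| * k * D := hk
      _ = cI * |κ| * (k * D) := by ring
  exact le_of_mul_le_mul_left h3 (mul_pos hcI hκ0)

end TwoAxis.Para

namespace Skelφ

open Literature.Probability.Percolation.KozmaNitzan.Cells (oth oth_ne eq_oth_of_ne oth_oth)
open TwoAxis.Para (coarse lam0 lam1 modulus)

variable {V : Type} {G : SimpleGraph V} {φ : V → Site 2}

/-! ## §1 The fine cell-aligned skeleton (one multiplier per axis) -/

variable (φ) in
/-- **The fine skeleton** of the cell lattice about `t`: `w ↦ (⌊(c₀·λ₀ + s₀)/D⌋, ⌊(c₁·λ₁ + s₁)/D⌋)` of the relative position — `coarseSkel` with one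
multiplier per axis (`c_i = 20K·m_i`). [this work] -/
def fineSkel (t : V) (A n h vα vβ c₀ c₁ s₀ s₁ D : ℤ) : V → Site 2 := fun w =>
  ![coarse c₀ s₀ D (lam0 A vα vβ (relφ φ t w)), coarse c₁ s₁ D (lam1 A n h (relφ φ t w))]

/-- The coarse skeleton is the diagonal case `c₀ = c₁`. [folklore] -/
theorem coarseSkel_eq_fineSkel (t : V) (A n h vα vβ c s₀ s₁ D : ℤ) :
    coarseSkel φ t A n h vα vβ c s₀ s₁ D = fineSkel φ t A n h vα vβ c c s₀ s₁ D := rfl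

/-- Coordinate `0` of the fine skeleton. [folklore] -/
@[simp] theorem fineSkel_apply_zero (t : V) (A n h vα vβ c₀ c₁ s₀ s₁ D : ℤ) (w : V) :
    fineSkel φ t A n h vα vβ c₀ c₁ s₀ s₁ D w 0 = coarse c₀ s₀ D (lam0 A vα vβ (relφ φ t w)) := rfl

/-- Coordinate `1` of the fine skeleton. [folklore] -/
@[simp] theorem fineSkel_apply_one (t : V) (A n h vα vβ c₀ c₁ s₀ s₁ D : ℤ) (w : V) :
    fineSkel φ t A n h vα vβ c₀ c₁ s₀ s₁ D w 1 = coarse c₁ s₁ D (lam1 A n h (relφ φ t w)) := rfl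

/-- **The fine skeleton is 1-Lipschitz** as soon as `c₀·|A|(|vβ|+|vα|) ≤ D` and `c₁·|A|(|n|+|h|) ≤ D` (true by the choice `c_i = 20K·⌊D/(20K·L_i)⌋`).
[cite: MartineauTassion2017, §4.3] -/
theorem lip_fineSkel (hlip : Lip G φ) (t : V) {A n h vα vβ c₀ c₁ s₀ s₁ D : ℤ} (hc₀ : 0 ≤ c₀) (hc₁ : 0 ≤ c₁) (hD : 0 < D)
    (hL0 : c₀ * (|A| * (|vβ| + |vα|)) ≤ D) (hL1 : c₁ * (|A| * (|n| + |h|)) ≤ D) : Lip G (fineSkel φ t A n h vα vβ c₀ c₁ s₀ s₁ D) := by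
  intro u v huv i
  have h0 := lip_relφ hlip t huv 0
  have h1 := lip_relφ hlip t huv 1
  fin_cases i
  · exact TwoAxis.Para.abs_coarse_sub_le_one hc₀ hD hL0 (TwoAxis.Para.abs_lam0_sub_le A vα vβ h0 h1)
  · exact TwoAxis.Para.abs_coarse_sub_le_one hc₁ hD hL1 (TwoAxis.Para.abs_lam1_sub_le A n h h0 h1)

/-- **FINE CONTAINMENT**: planar positions within `s` in each coordinate have fine positions within `k₀`, `k₁` as soon as `c₀·|A|(|vβ|+|vα|)·s ≤ k₀·D`
and `c₁·|A|(|n|+|h|)·s ≤ k₁·D` — a φ-square of size `s` about a kit centre lies in the fine box `[−k₀,k₀] × [−k₁,k₁]` about its fine position.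
[cite: KozmaNitzan2024, §4 Lemma 10 Step IV] -/
theorem fine_containment (t : V) {A n h vα vβ c₀ c₁ s₀ s₁ D s k₀ k₁ : ℤ} (hD : 0 < D) (hc₀ : 0 ≤ c₀) (hc₁ : 0 ≤ c₁)
    (hL0 : c₀ * (|A| * (|vβ| + |vα|) * s) ≤ k₀ * D) (hL1 : c₁ * (|A| * (|n| + |h|) * s) ≤ k₁ * D)
    {w w' : V} (h0 : |φ w 0 - φ w' 0| ≤ s) (h1 : |φ w 1 - φ w' 1| ≤ s) :
    |fineSkel φ t A n h vα vβ c₀ c₁ s₀ s₁ D w 0 - fineSkel φ t A n h vα vβ c₀ c₁ s₀ s₁ D w' 0| ≤ k₀ ∧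
      |fineSkel φ t A n h vα vβ c₀ c₁ s₀ s₁ D w 1 - fineSkel φ t A n h vα vβ c₀ c₁ s₀ s₁ D w' 1| ≤ k₁ := by
  have hl0 : |lam0 A vα vβ (relφ φ t w) - lam0 A vα vβ (relφ φ t w')| ≤ |A| * (|vβ| + |vα|) * s := by
    have e : lam0 A vα vβ (relφ φ t w) - lam0 A vα vβ (relφ φ t w') = A * (vβ * (φ w 0 - φ w' 0) - vα * (φ w 1 - φ w' 1)) := by
      simp only [TwoAxis.Para.lam0, relφ_apply]; ring
    rw [e, abs_mul]
    calc |A| * |vβ * (φ w 0 - φ w' 0) - vα * (φ w 1 - φ w' 1)| ≤ |A| * (|vβ| * s + |vα| * s) := by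
          refine mul_le_mul_of_nonneg_left ?_ (abs_nonneg A)
          calc |vβ * (φ w 0 - φ w' 0) - vα * (φ w 1 - φ w' 1)| ≤ |vβ * (φ w 0 - φ w' 0)| + |vα * (φ w 1 - φ w' 1)| := abs_sub _ _
            _ = |vβ| * |φ w 0 - φ w' 0| + |vα| * |φ w 1 - φ w' 1| := by rw [abs_mul, abs_mul]
            _ ≤ |vβ| * s + |vα| * s := by gcongr
      _ = |A| * (|vβ| + |vα|) * s := by ring
  have hl1 : |lam1 A n h (relφ φ t w) - lam1 A n h (relφ φ t w')| ≤ |A| * (|n| + |h|) * s := by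
    have e : lam1 A n h (relφ φ t w) - lam1 A n h (relφ φ t w') = A * (n * (φ w 1 - φ w' 1) - h * (φ w 0 - φ w' 0)) := by
      simp only [TwoAxis.Para.lam1, TwoAxis.Para.bp, relφ_apply]; ring
    rw [e, abs_mul]
    calc |A| * |n * (φ w 1 - φ w' 1) - h * (φ w 0 - φ w' 0)| ≤ |A| * (|n| * s + |h| * s) := by
          refine mul_le_mul_of_nonneg_left ?_ (abs_nonneg A)
          calc |n * (φ w 1 - φ w' 1) - h * (φ w 0 - φ w' 0)| ≤ |n * (φ w 1 - φ w' 1)| + |h * (φ w 0 - φ w' 0)| := abs_sub _ _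
            _ = |n| * |φ w 1 - φ w' 1| + |h| * |φ w 0 - φ w' 0| := by rw [abs_mul, abs_mul]
            _ ≤ |n| * s + |h| * s := by gcongr
      _ = |A| * (|n| + |h|) * s := by ring
  rw [fineSkel_apply_zero, fineSkel_apply_zero, fineSkel_apply_one, fineSkel_apply_one]
  constructor
  · refine TwoAxis.Para.abs_coarse_sub_le_of_mul hD ?_
    rw [← mul_sub, abs_mul, abs_of_nonneg hc₀]
    exact (mul_le_mul_of_nonneg_left hl0 hc₀).trans hL0
  · refine TwoAxis.Para.abs_coarse_sub_le_of_mul hD ?_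
    rw [← mul_sub, abs_mul, abs_of_nonneg hc₁]
    exact (mul_le_mul_of_nonneg_left hl1 hc₁).trans hL1

/-! ## §2 The two face frames (exit frames at the cell's own level coordinate) -/

/-- `c·λ₁ = linForm (−cAh) (cAn)`. [folklore] -/
theorem mul_lam1_eq_linForm (c A n h : ℤ) (x : Site 2) : c * lam1 A n h x = linForm (-(c * A * h)) (c * A * n) x := by
  unfold lam1 TwoAxis.Para.bp linForm; ring

/-- `c·λ₀ = linForm (cAvβ) (−cAvα)`. [folklore] -/
theorem mul_lam0_eq_linForm (c A vα vβ : ℤ) (x : Site 2) : c * lam0 A vα vβ x = linForm (c * A * vβ) (-(c * A * vα)) x := by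
  unfold lam0 linForm; ring

/-- `coarse c s D t = coarse 1 s D (c·t)`. [folklore] -/
theorem coarse_eq_coarse_one (c s D t : ℤ) : coarse c s D t = coarse 1 s D (c * t) := by unfold coarse; ring_nf

variable (φ) in
/-- **The u-face frame** (faces `∥ u`, crossed along the cell axis `1`): the exit frame of `c₁·λ₁`, level at index `1`, raw coordinate `b` at index `0`.
[this work] -/
def uFrame (t : V) (A n h c₁ s₁ D : ℤ) (b : Fin 2) : V → Site 2 := exitFrame φ t 1 b (-(c₁ * A * h)) (c₁ * A * n) D s₁

variable (φ) in
/-- **The v-face frame** (faces `∥ v`, crossed along the cell axis `0`): the exit frame of `c₀·λ₀`, level at index `0`, raw coordinate `b` at index `1`.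
[this work] -/
def vFrame (t : V) (A vα vβ c₀ s₀ D : ℤ) (b : Fin 2) : V → Site 2 := exitFrame φ t 0 b (c₀ * A * vβ) (-(c₀ * A * vα)) D s₀

/-- **The u-face frame's level coordinate IS the cell coordinate `1`.** [this work] -/
theorem uFrame_apply_one (t : V) (A n h vα vβ c₀ c₁ s₀ s₁ D : ℤ) (b : Fin 2) (w : V) :
    uFrame φ t A n h c₁ s₁ D b w 1 = fineSkel φ t A n h vα vβ c₀ c₁ s₀ s₁ D w 1 := by
  rw [uFrame, exitFrame_apply_self, fineSkel_apply_one, coarse_eq_coarse_one c₁, mul_lam1_eq_linForm]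

/-- The u-face frame's raw coordinate. [folklore] -/
theorem uFrame_apply_zero (t : V) (A n h c₁ s₁ D : ℤ) (b : Fin 2) (w : V) : uFrame φ t A n h c₁ s₁ D b w 0 = relφ φ t w b := by
  rw [uFrame, show (0 : Fin 2) = oth 1 from rfl, exitFrame_apply_oth]

/-- **The v-face frame's level coordinate IS the cell coordinate `0`.** [this work] -/
theorem vFrame_apply_zero (t : V) (A n h vα vβ c₀ c₁ s₀ s₁ D : ℤ) (b : Fin 2) (w : V) :
    vFrame φ t A vα vβ c₀ s₀ D b w 0 = fineSkel φ t A n h vα vβ c₀ c₁ s₀ s₁ D w 0 := by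
  rw [vFrame, exitFrame_apply_self, fineSkel_apply_zero, coarse_eq_coarse_one c₀, mul_lam0_eq_linForm]

/-- The v-face frame's raw coordinate. [folklore] -/
theorem vFrame_apply_one (t : V) (A vα vβ c₀ s₀ D : ℤ) (b : Fin 2) (w : V) : vFrame φ t A vα vβ c₀ s₀ D b w 1 = relφ φ t w b := by
  rw [vFrame, show (1 : Fin 2) = oth 0 from rfl, exitFrame_apply_oth]

/-- `|−cAh| + |cAn| = c·|A|·(|n| + |h|)` for `0 ≤ c`. [folklore] -/
theorem abs_ucoef (c A n h : ℤ) (hc : 0 ≤ c) : |-(c * A * h)| + |c * A * n| = c * (|A| * (|n| + |h|)) := by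
  rw [abs_neg, abs_mul, abs_mul, abs_mul, abs_mul, abs_of_nonneg hc]; ring

/-- `|cAvβ| + |−cAvα| = c·|A|·(|vβ| + |vα|)` for `0 ≤ c`. [folklore] -/
theorem abs_vcoef (c A vα vβ : ℤ) (hc : 0 ≤ c) : |c * A * vβ| + |-(c * A * vα)| = c * (|A| * (|vβ| + |vα|)) := by
  rw [abs_neg, abs_mul, abs_mul, abs_mul, abs_mul, abs_of_nonneg hc]; ring

/-- The u-face frame is 1-Lipschitz (`c₁·|A|(|n|+|h|) ≤ D`). [this work] -/
theorem lip_uFrame (hlip : Lip G φ) (t : V) {A n h c₁ : ℤ} (s₁ : ℤ) {D : ℤ} (b : Fin 2) (hc₁ : 0 ≤ c₁) (hD : 0 < D)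
    (hL1 : c₁ * (|A| * (|n| + |h|)) ≤ D) : Lip G (uFrame φ t A n h c₁ s₁ D b) :=
  lip_exitFrame hlip t 1 b s₁ hD (by rw [abs_ucoef c₁ A n h hc₁]; exact hL1)

/-- The v-face frame is 1-Lipschitz (`c₀·|A|(|vβ|+|vα|) ≤ D`). [this work] -/
theorem lip_vFrame (hlip : Lip G φ) (t : V) {A vα vβ c₀ : ℤ} (s₀ : ℤ) {D : ℤ} (b : Fin 2) (hc₀ : 0 ≤ c₀) (hD : 0 < D)
    (hL0 : c₀ * (|A| * (|vβ| + |vα|)) ≤ D) : Lip G (vFrame φ t A vα vβ c₀ s₀ D b) :=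
  lip_exitFrame hlip t 0 b s₀ hD (by rw [abs_vcoef c₀ A vα vβ hc₀]; exact hL0)

/-- **The u-face frame has quasi-steps**: raw axis `b` with `|coef b| ≤ |coef (oth b)|` (i.e. `b = 0` when `|h| ≤ |n|`, `b = 1` when `|n| ≤ |h|`),
the inward coefficient nonzero, and `c₁|A|(|n|+|h|) ≤ D ≤ 3·|inward coefficient|` (fine unit at most `3/2` Lipschitz units). [this work] -/
theorem qSteps_uFrame (hstep : Steps G φ) (t : V) {A n h c₁ s₁ D : ℤ} {b : Fin 2} (hc₁ : 0 ≤ c₁) (hD : 0 < D)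
    (hL1 : c₁ * (|A| * (|n| + |h|)) ≤ D)
    (hab : |coef (-(c₁ * A * h)) (c₁ * A * n) b| ≤ |coef (-(c₁ * A * h)) (c₁ * A * n) (oth b)|)
    (hca : 0 < |coef (-(c₁ * A * h)) (c₁ * A * n) (oth b)|) (hU3 : D ≤ 3 * |coef (-(c₁ * A * h)) (c₁ * A * n) (oth b)|) :
    QSteps G (uFrame φ t A n h c₁ s₁ D b) :=
  qSteps_exitFrame t hstep hD (by rw [abs_ucoef c₁ A n h hc₁]; exact hL1) hab hca hU3

/-- **The v-face frame has quasi-steps** (raw axis `b = 1` when `|vα| ≤ |vβ|`, `b = 0` when `|vβ| ≤ |vα|`). [this work] -/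
theorem qSteps_vFrame (hstep : Steps G φ) (t : V) {A vα vβ c₀ s₀ D : ℤ} {b : Fin 2} (hc₀ : 0 ≤ c₀) (hD : 0 < D)
    (hL0 : c₀ * (|A| * (|vβ| + |vα|)) ≤ D)
    (hab : |coef (c₀ * A * vβ) (-(c₀ * A * vα)) b| ≤ |coef (c₀ * A * vβ) (-(c₀ * A * vα)) (oth b)|)
    (hca : 0 < |coef (c₀ * A * vβ) (-(c₀ * A * vα)) (oth b)|) (hU3 : D ≤ 3 * |coef (c₀ * A * vβ) (-(c₀ * A * vα)) (oth b)|) :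
    QSteps G (vFrame φ t A vα vβ c₀ s₀ D b) :=
  qSteps_exitFrame t hstep hD (by rw [abs_vcoef c₀ A vα vβ hc₀]; exact hL0) hab hca hU3

/-- The coefficients of the u-face form, read per axis: `|coef 0| = c₁|A||h|`, `|coef 1| = c₁|A||n|` (`0 ≤ c₁`). [folklore] -/
theorem abs_coef_u (c₁ A n h : ℤ) (hc₁ : 0 ≤ c₁) :
    |coef (-(c₁ * A * h)) (c₁ * A * n) 0| = c₁ * |A| * |h| ∧ |coef (-(c₁ * A * h)) (c₁ * A * n) 1| = c₁ * |A| * |n| := by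
  simp only [coef, if_true, show (1 : Fin 2) ≠ 0 by decide, if_false, abs_neg, abs_mul, abs_of_nonneg hc₁]; exact ⟨trivial, trivial⟩

/-- The coefficients of the v-face form: `|coef 0| = c₀|A||vβ|`, `|coef 1| = c₀|A||vα|` (`0 ≤ c₀`). [folklore] -/
theorem abs_coef_v (c₀ A vα vβ : ℤ) (hc₀ : 0 ≤ c₀) :
    |coef (c₀ * A * vβ) (-(c₀ * A * vα)) 0| = c₀ * |A| * |vβ| ∧ |coef (c₀ * A * vβ) (-(c₀ * A * vα)) 1| = c₀ * |A| * |vα| := by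
  simp only [coef, if_true, show (1 : Fin 2) ≠ 0 by decide, if_false, abs_neg, abs_mul, abs_of_nonneg hc₀]; exact ⟨trivial, trivial⟩

/-! ## §3 Reading a face-frame box in the cell map: the other cell coordinate along the frame -/

section Read

variable (t : V) {A n h vα vβ c₀ c₁ s₀ s₁ D : ℤ} (hc₀ : 0 < c₀) (hc₁ : 0 < c₁) (hD : 0 < D) {w w' : V} {a d k : ℤ}
include hc₀ hc₁ hD

/-- **u-face frame, raw axis `α` (`|h| ≤ n`, `n ≠ 0`): the cell coordinate `0` along a frame box.** If the raw coordinates differ by `≤ a` and the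
levels (cell coordinate `1`) by `≤ d`, then cell coordinate `0` differs by `≤ k`, provided `c₀c₁|A·mod|·a + c₀|vα|(d+1)D ≤ c₁|n|·k·D`
(from `n·λ₀ = A·mod·α − vα·λ₁`). [this work] -/
theorem uFrame_read_zero (hn : n ≠ 0) (ha : |relφ φ t w 0 - relφ φ t w' 0| ≤ a)
    (hd : |fineSkel φ t A n h vα vβ c₀ c₁ s₀ s₁ D w 1 - fineSkel φ t A n h vα vβ c₀ c₁ s₀ s₁ D w' 1| ≤ d)
    (hk : c₀ * c₁ * |A * modulus n h vα vβ| * a + c₀ * |vα| * (d + 1) * D ≤ c₁ * |n| * k * D) :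
    |fineSkel φ t A n h vα vβ c₀ c₁ s₀ s₁ D w 0 - fineSkel φ t A n h vα vβ c₀ c₁ s₀ s₁ D w' 0| ≤ k := by
  rw [fineSkel_apply_one, fineSkel_apply_one] at hd
  rw [fineSkel_apply_zero, fineSkel_apply_zero]
  refine TwoAxis.Para.abs_coarse_sub_le_of_mul hD ?_
  rw [← mul_sub]
  have hid : n * (lam0 A vα vβ (relφ φ t w) - lam0 A vα vβ (relφ φ t w')) =
      A * modulus n h vα vβ * (relφ φ t w 0 - relφ φ t w' 0) - vα * (lam1 A n h (relφ φ t w) - lam1 A n h (relφ φ t w')) := by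
    have e1 := (TwoAxis.Para.mul_lam_eq' A n h vα vβ (relφ φ t w)).1
    have e2 := (TwoAxis.Para.mul_lam_eq' A n h vα vβ (relφ φ t w')).1
    linear_combination e1 - e2
  exact TwoAxis.Para.abs_le_of_identity hid hn hc₁ hc₀.le ha
    (by rw [mul_sub]; exact TwoAxis.Para.abs_mul_sub_lt_of_coarse hD hd) hk

/-- **u-face frame, raw axis `β` (`|n| ≤ |h|`, `h ≠ 0`)**: as `uFrame_read_zero` with `h·λ₀ = A·mod·β − vβ·λ₁`; room
`c₀c₁|A·mod|·a + c₀|vβ|(d+1)D ≤ c₁|h|·k·D`. [this work] -/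
theorem uFrame_read_zero' (hh : h ≠ 0) (ha : |relφ φ t w 1 - relφ φ t w' 1| ≤ a)
    (hd : |fineSkel φ t A n h vα vβ c₀ c₁ s₀ s₁ D w 1 - fineSkel φ t A n h vα vβ c₀ c₁ s₀ s₁ D w' 1| ≤ d)
    (hk : c₀ * c₁ * |A * modulus n h vα vβ| * a + c₀ * |vβ| * (d + 1) * D ≤ c₁ * |h| * k * D) :
    |fineSkel φ t A n h vα vβ c₀ c₁ s₀ s₁ D w 0 - fineSkel φ t A n h vα vβ c₀ c₁ s₀ s₁ D w' 0| ≤ k := by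
  rw [fineSkel_apply_one, fineSkel_apply_one] at hd
  rw [fineSkel_apply_zero, fineSkel_apply_zero]
  refine TwoAxis.Para.abs_coarse_sub_le_of_mul hD ?_
  rw [← mul_sub]
  have hid : h * (lam0 A vα vβ (relφ φ t w) - lam0 A vα vβ (relφ φ t w')) =
      A * modulus n h vα vβ * (relφ φ t w 1 - relφ φ t w' 1) - vβ * (lam1 A n h (relφ φ t w) - lam1 A n h (relφ φ t w')) := by
    have e1 := (TwoAxis.Para.mul_lam_eq' A n h vα vβ (relφ φ t w)).2
    have e2 := (TwoAxis.Para.mul_lam_eq' A n h vα vβ (relφ φ t w')).2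
    linear_combination e1 - e2
  exact TwoAxis.Para.abs_le_of_identity hid hh hc₁ hc₀.le ha
    (by rw [mul_sub]; exact TwoAxis.Para.abs_mul_sub_lt_of_coarse hD hd) hk

/-- **v-face frame, raw axis `α` (`|vβ| ≤ |vα|`, `vα ≠ 0`): the cell coordinate `1` along a frame box**, from `vα·λ₁ = A·mod·α − n·λ₀`; room
`c₁c₀|A·mod|·a + c₁|n|(d+1)D ≤ c₀|vα|·k·D`. [this work] -/
theorem vFrame_read_one (hv : vα ≠ 0) (ha : |relφ φ t w 0 - relφ φ t w' 0| ≤ a)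
    (hd : |fineSkel φ t A n h vα vβ c₀ c₁ s₀ s₁ D w 0 - fineSkel φ t A n h vα vβ c₀ c₁ s₀ s₁ D w' 0| ≤ d)
    (hk : c₁ * c₀ * |A * modulus n h vα vβ| * a + c₁ * |n| * (d + 1) * D ≤ c₀ * |vα| * k * D) :
    |fineSkel φ t A n h vα vβ c₀ c₁ s₀ s₁ D w 1 - fineSkel φ t A n h vα vβ c₀ c₁ s₀ s₁ D w' 1| ≤ k := by
  rw [fineSkel_apply_zero, fineSkel_apply_zero] at hd
  rw [fineSkel_apply_one, fineSkel_apply_one]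
  refine TwoAxis.Para.abs_coarse_sub_le_of_mul hD ?_
  rw [← mul_sub]
  have hid : vα * (lam1 A n h (relφ φ t w) - lam1 A n h (relφ φ t w')) =
      A * modulus n h vα vβ * (relφ φ t w 0 - relφ φ t w' 0) - n * (lam0 A vα vβ (relφ φ t w) - lam0 A vα vβ (relφ φ t w')) := by
    have e1 := (TwoAxis.Para.mul_lam_eq' A n h vα vβ (relφ φ t w)).1
    have e2 := (TwoAxis.Para.mul_lam_eq' A n h vα vβ (relφ φ t w')).1
    linear_combination e1 - e2
  exact TwoAxis.Para.abs_le_of_identity hid hv hc₀ hc₁.le ha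
    (by rw [mul_sub]; exact TwoAxis.Para.abs_mul_sub_lt_of_coarse hD hd) hk

/-- **v-face frame, raw axis `β` (`|vα| ≤ |vβ|`, `vβ ≠ 0`)**, from `vβ·λ₁ = A·mod·β − h·λ₀`; room `c₁c₀|A·mod|·a + c₁|h|(d+1)D ≤ c₀|vβ|·k·D`.
[this work] -/
theorem vFrame_read_one' (hv : vβ ≠ 0) (ha : |relφ φ t w 1 - relφ φ t w' 1| ≤ a)
    (hd : |fineSkel φ t A n h vα vβ c₀ c₁ s₀ s₁ D w 0 - fineSkel φ t A n h vα vβ c₀ c₁ s₀ s₁ D w' 0| ≤ d)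
    (hk : c₁ * c₀ * |A * modulus n h vα vβ| * a + c₁ * |h| * (d + 1) * D ≤ c₀ * |vβ| * k * D) :
    |fineSkel φ t A n h vα vβ c₀ c₁ s₀ s₁ D w 1 - fineSkel φ t A n h vα vβ c₀ c₁ s₀ s₁ D w' 1| ≤ k := by
  rw [fineSkel_apply_zero, fineSkel_apply_zero] at hd
  rw [fineSkel_apply_one, fineSkel_apply_one]
  refine TwoAxis.Para.abs_coarse_sub_le_of_mul hD ?_
  rw [← mul_sub]
  have hid : vβ * (lam1 A n h (relφ φ t w) - lam1 A n h (relφ φ t w')) =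
      A * modulus n h vα vβ * (relφ φ t w 1 - relφ φ t w' 1) - h * (lam0 A vα vβ (relφ φ t w) - lam0 A vα vβ (relφ φ t w')) := by
    have e1 := (TwoAxis.Para.mul_lam_eq' A n h vα vβ (relφ φ t w)).2
    have e2 := (TwoAxis.Para.mul_lam_eq' A n h vα vβ (relφ φ t w')).2
    linear_combination e1 - e2
  exact TwoAxis.Para.abs_le_of_identity hid hv hc₀ hc₁.le ha
    (by rw [mul_sub]; exact TwoAxis.Para.abs_mul_sub_lt_of_coarse hD hd) hk

end Read

end Skelφ

end Summit.CriticalPhenomena.PercolationContinuityZ3.Theorems.Transplant
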